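import Mathlib
import Literature.Analysis.FluidPDE.AxisymmetricEuler
import Literature.Analysis.FluidPDE.VectorCalculus
import Literature.Analysis.FluidPDE.DecayingSelfSimilarEulerProfile
import HarnessLib

/-!
# HOOP DEFINITIONS — the objects of the hoop / axis-law line (route `EulerZoomLiouville`, crux E = stmt-NavierStokesRegularity-19832)

Definitions file (LEAD 19832, ns-typeII-p2 g14; `--supports stmt-NavierStokesRegularity-19832`): the objects and the three target
`Prop`s of ns-idea-11 g8's HOOP NOTE (`Cruxes/PowerGaugeEulerLiouville/HOOP-NOTE.md` dc156936fff7, `HoopSketch.lean` v2 7b104d8a088b),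
moved VERBATIM (notation spelled out) from the Cruxes sketch into an importable `Theorems` module, so that (i) the provers of
`HoopInequality` (K-HOOP, class-free, PROVABLE-M) and of `AxisLaw γ` / `AxisLawIntegrated γ` (K-AXIS) and (ii) the LEAD's skeleton
`Lines/birth.lean` (future `HasFastVorticalChannel` alternative «no straight pressurised radial run longer than C‖y‖^{−1−ρ}», T-J′)
can refer to the SAME declarations.  Nothing is proved here.

Objects (cylinder coordinates about the RADIAL `x₂`-axis; `cylRadius`, `eR`, `eTheta`, `eZ`, `rotZ`, `radialVelocity`,
`swirlVelocity`, `axialVelocity` from `Literature.Analysis.FluidPDE.AxisymmetricEuler`):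
* `solidCyl s₁ s₂ T₀` — the solid cylinder `{s₁ ≤ y₂ ≤ s₂, cylRadius y ≤ T₀}`; `liftAt σ z` — the point `(z₀, z₁, σ)`;
* `hoopDensity V y` — the atom-subtracted hoop density `[(V_r² − V_θ²)(y) − ((v·e_r)² − (v·e_θ)²)]/r²`, `v = V(y₂ e_z)`;
* `endFlux V σ T₀` — the end-disc flux `∫_{‖z‖ ≤ T₀} (V_r² + V_z²)/‖z‖`;
* `axisPt`, `circleAvg`, `endTerm γ V T₀ σ` — cylinder points, azimuthal averages, the end functional `E(σ) = ∫₀^{T₀} ⟨W_z V_r⟩_θ dt`.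
Targets: `HoopInequality` (HOOP-NOTE §4: hoop functional ≤ Frobenius energy + axis atom + end fluxes), `AxisLaw γ` (§2, (AX)),
`AxisLawIntegrated γ` ((AX∫)).  READING (HOOP-NOTE §3–§5; LEAD memo RESIDUE-MEMO-19832-g14 §11c/§11d): cost and holding of an axis pressure
ridge carry the SAME measure `dy/t²`, so a straight pressurised radial run of a self-similar profile longer than `C‖y‖^{−1−ρ}` is
excluded by the E-budget — the first lever of the programme not of the form «type ≥ constant».

WHAT THIS IS NOT: not NS, not E — definitions for hypothetical profiles; 19832 OPEN; NS regularity NOT proved.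
[ns-idea-11 g8 HOOP NOTE; folklore (azimuthal Fourier modes; the profile equation tested against `∇_⊥ log t`)]
-/

noncomputable section

open MeasureTheory Set WithLp
open scoped InnerProductSpace RealInnerProductSpace

set_option linter.dupNamespace false

namespace Summit.NavierStokesRegularity.NavierStokesRegularity.Theorems.PowerGaugeEulerLiouville.HoopCore

open Literature.Analysis.FluidPDE


/-- The solid cylinder `{s₁ ≤ y₂ ≤ s₂, cylRadius y ≤ T₀}` about the `x₂`-axis (a RADIAL axis: it passes through the origin). -/
def solidCyl (s₁ s₂ T₀ : ℝ) : Set (EuclideanSpace ℝ (Fin 3)) :=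
  {y | s₁ ≤ y 2 ∧ y 2 ≤ s₂ ∧ cylRadius y ≤ T₀}

/-- The point of the transverse disc at height `σ`: `(z₀, z₁, σ)`. -/
def liftAt (σ : ℝ) (z : (EuclideanSpace ℝ (Fin 2))) : (EuclideanSpace ℝ (Fin 3)) :=
  toLp 2 ![z 0, z 1, σ]

/-- Atom-subtracted hoop density `[(V_r² − V_θ²)(y) − ((v·e_r(y))² − (v·e_θ(y))²)] / r(y)²`, `v := V (y₂ • e_z)` the velocity
ON THE AXIS at the same height (the subtraction makes the density `O(1/r)`, hence integrable on the solid cylinder, for `C¹ V`;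
its azimuthal average is unchanged).  Junk `0` on the axis (null set). -/
noncomputable def hoopDensity (V : (EuclideanSpace ℝ (Fin 3)) → (EuclideanSpace ℝ (Fin 3))) (y : (EuclideanSpace ℝ (Fin 3))) : ℝ :=
  ((radialVelocity V y) ^ 2 - (swirlVelocity V y) ^ 2
      - (⟪V ((y 2) • eZ), eR y⟫ ^ 2 - ⟪V ((y 2) • eZ), eTheta y⟫ ^ 2)) / (cylRadius y) ^ 2

/-- End-disc flux at height `σ`: `∫_{‖z‖ ≤ T₀} (V_r² + V_z²)(z, σ) / ‖z‖ dA(z)` (integrable: `1/‖z‖` in the plane). -/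
noncomputable def endFlux (V : (EuclideanSpace ℝ (Fin 3)) → (EuclideanSpace ℝ (Fin 3))) (σ T₀ : ℝ) : ℝ :=
  ∫ z in Metric.closedBall (0 : (EuclideanSpace ℝ (Fin 2))) T₀,
    ((radialVelocity V (liftAt σ z)) ^ 2 + (axialVelocity V (liftAt σ z)) ^ 2) / ‖z‖

/-- FIRST LEMMA (hoop inequality; HOOP-NOTE §4; constant 1 with the Frobenius norm):
for `C¹` divergence-free `V` and the solid cylinder `Z = solidCyl s₁ s₂ T₀`,
`∫_Z hoopDensity V ≤ ∫_Z |DV|_F² + π ∫_{s₁}^{s₂} ‖V(σ e_z)‖² dσ + endFlux(s₁) + endFlux(s₂)`. -/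
def HoopInequality : Prop :=
  ∀ (V : (EuclideanSpace ℝ (Fin 3)) → (EuclideanSpace ℝ (Fin 3))) (s₁ s₂ T₀ : ℝ), s₁ < s₂ → 0 < T₀ → ContDiff ℝ 1 V →
    (∀ y, VectorCalculus.divergence V y = 0) →
      ∫ y in solidCyl s₁ s₂ T₀, hoopDensity V y
        ≤ (∫ y in solidCyl s₁ s₂ T₀, frobeniusNormSq (fderiv ℝ V y))
          + Real.pi * (∫ σ in s₁..s₂, ‖V (σ • eZ)‖ ^ 2)
          + endFlux V s₁ T₀ + endFlux V s₂ T₀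

/-! ### The axis law (AX) — typed form of HOOP-NOTE §2 (T-K″ candidate; PROVABLE-L; nothing proved here) -/

/-- The point with cylinder coordinates `(s, t, θ)` about the `x₂`-axis: `rotZ θ (s•e_z + t•e₀)`. -/
noncomputable def axisPt (s t θ : ℝ) : (EuclideanSpace ℝ (Fin 3)) :=
  rotZ θ (s • eZ + t • EuclideanSpace.single 0 1)

/-- Azimuthal (circle) average `⟨f⟩_θ (s,t) = (2π)⁻¹ ∫₀^{2π} f (axisPt s t θ) dθ`. -/
noncomputable def circleAvg (f : (EuclideanSpace ℝ (Fin 3)) → ℝ) (s t : ℝ) : ℝ :=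
  (1 / (2 * Real.pi)) * ∫ θ in (0 : ℝ)..(2 * Real.pi), f (axisPt s t θ)

/-- The end functional `E(σ) = ∫₀^{T₀} ⟨W_s V_r⟩_θ (σ,t) dt`, `W_s = γ σ + V_z` (similarity transport field `W = γy + V`, axial part). -/
noncomputable def endTerm (γ : ℝ) (V : (EuclideanSpace ℝ (Fin 3)) → (EuclideanSpace ℝ (Fin 3))) (T₀ σ : ℝ) : ℝ :=
  ∫ t in (0 : ℝ)..T₀, circleAvg (fun y => (γ * (y 2) + axialVelocity V y) * radialVelocity V y) σ t

/-- AXIS LAW (AX) (HOOP-NOTE §2; the profile equation `(1−γ)V + DV[γy+V] + ∇P = 0`, `div V = 0` tested against `∇_⊥ log t`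
about the RADIAL axis `ℝ e_z`; checked by hand on linear flows and numerically, kit j321874, rel. residual 6.4e−6):
for every `s` and `T₀ > 0`,
`P(s e_z) − ⟨P⟩_θ(s,T₀) = ∫₀^{T₀} ⟨V_r² − V_θ²⟩_θ dt/t − ½‖V_⊥(s e_z)‖² + (1−3γ)∫₀^{T₀}⟨V_r⟩_θ dt + ⟨(γt + V_r)V_r⟩_θ(s,T₀) + E′(s)`.
(`‖V_⊥‖² = ‖V‖² − V_z²`; the first integrand is `O(t)` at the axis for `C²` fields, so the interval integral is a genuine one.) -/
def AxisLaw (γ : ℝ) : Prop :=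
  ∀ (V : (EuclideanSpace ℝ (Fin 3)) → (EuclideanSpace ℝ (Fin 3))) (P : (EuclideanSpace ℝ (Fin 3)) → ℝ), IsSelfSimilarEulerProfile γ 0 V P →
    ∀ (s T₀ : ℝ), 0 < T₀ →
      P (s • eZ) - circleAvg P s T₀
        = (∫ t in (0 : ℝ)..T₀, circleAvg (fun y => radialVelocity V y ^ 2 - swirlVelocity V y ^ 2) s t / t)
          - (1 / 2) * (‖V (s • eZ)‖ ^ 2 - axialVelocity V (s • eZ) ^ 2)
          + (1 - 3 * γ) * (∫ t in (0 : ℝ)..T₀, circleAvg (radialVelocity V) s t)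
          + circleAvg (fun y => (γ * cylRadius y + radialVelocity V y) * radialVelocity V y) s T₀
          + deriv (endTerm γ V T₀) s

/-- Integrated form (AX∫) over a radial segment `[s₁, s₂]` (FTC on `AxisLaw`; this is the form paired with `HoopInequality`):
`∫_{s₁}^{s₂} [P(σe_z) − ⟨P⟩_θ(σ,T₀)] dσ = ∫∫⟨V_r²−V_θ²⟩dt/t dσ − ½∫‖V_⊥‖² + (1−3γ)∫∫⟨V_r⟩ + ∫⟨(γT₀+V_r)V_r⟩(σ,T₀)dσ + E(s₂) − E(s₁)`. -/
def AxisLawIntegrated (γ : ℝ) : Prop :=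
  ∀ (V : (EuclideanSpace ℝ (Fin 3)) → (EuclideanSpace ℝ (Fin 3))) (P : (EuclideanSpace ℝ (Fin 3)) → ℝ), IsSelfSimilarEulerProfile γ 0 V P →
    ∀ (s₁ s₂ T₀ : ℝ), s₁ ≤ s₂ → 0 < T₀ →
      ∫ σ in s₁..s₂, (P (σ • eZ) - circleAvg P σ T₀)
        = (∫ σ in s₁..s₂, ∫ t in (0 : ℝ)..T₀, circleAvg (fun y => radialVelocity V y ^ 2 - swirlVelocity V y ^ 2) σ t / t)
          - (1 / 2) * (∫ σ in s₁..s₂, (‖V (σ • eZ)‖ ^ 2 - axialVelocity V (σ • eZ) ^ 2))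
          + (1 - 3 * γ) * (∫ σ in s₁..s₂, ∫ t in (0 : ℝ)..T₀, circleAvg (radialVelocity V) σ t)
          + (∫ σ in s₁..s₂, circleAvg (fun y => (γ * cylRadius y + radialVelocity V y) * radialVelocity V y) σ T₀)
          + (endTerm γ V T₀ s₂ - endTerm γ V T₀ s₁)


/-! ### General-line axis law (HOOP-NOTE §8, HoopSketch v4 744f9e1a0fc7; appended by LEAD g14): arbitrary similarity centre `c`, i.e. an arbitrary straight axis -/

/-- End flux for a similarity flow centred at `c` (axis = `ℝ e_z`): `E_c(σ) = ∫₀^{T₀} ⟨(γ(y_z − c_z) + V_z)·V_r⟩_θ dt`. -/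
noncomputable def endTermC (γ : ℝ) (c : (EuclideanSpace ℝ (Fin 3))) (V : (EuclideanSpace ℝ (Fin 3)) → (EuclideanSpace ℝ (Fin 3))) (T₀ σ : ℝ) : ℝ :=
  ∫ t in (0 : ℝ)..T₀, circleAvg (fun y => (γ * (y 2 - c 2) + axialVelocity V y) * radialVelocity V y) σ t

/-- Offset flux (HOOP-NOTE §8): with `a = −c_⊥` the transverse offset of the axis from the similarity centre,
`F_c(σ) = γ ∫₀^{T₀} ⟨(a·e_r)·V_z⟩_θ dt`; the extra advection `γ(a·∇_⊥)V_⊥` tested against `∇_⊥ log t` over the disc is EXACTLY `−F_c′(σ)`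
(`(a·∇_⊥)V_⊥·∇_⊥log t = div_⊥((a)(V·∇_⊥log t)) − div_⊥(V_⊥ (a·∇_⊥log t)) − ∂_z[(a·∇_⊥log t)V_z]`, the two boundary integrals cancel on every circle). -/
noncomputable def offsetTerm (γ : ℝ) (c : (EuclideanSpace ℝ (Fin 3))) (V : (EuclideanSpace ℝ (Fin 3)) → (EuclideanSpace ℝ (Fin 3))) (T₀ σ : ℝ) : ℝ :=
  γ * ∫ t in (0 : ℝ)..T₀, circleAvg (fun y => (-(c 0 * eR y 0 + c 1 * eR y 1)) * axialVelocity V y) σ t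

/-- GENERAL-LINE AXIS LAW, integrated form (HOOP-NOTE §8; kit j322443 full period rel 2.5e-5, kit j322456 non-periodic window: the `offsetTerm` end term is required, residual 9.7e-4 with it vs 1.1e-1 without): for a profile pair with ARBITRARY similarity centre `c`
(equivalently: an arbitrary straight axis, radial or not, relative to the centre) the identity (AX∫) holds VERBATIM with `endTermC`
in place of `endTerm` and ONE extra exact end term `−[F_c]`; the centre enters nowhere else.  So the hoop pricing of a straight slow
Bernoulli-high core does not require the core to be radial. -/
def AxisLawCentre (γ : ℝ) : Prop :=
  ∀ (c : (EuclideanSpace ℝ (Fin 3))) (V : (EuclideanSpace ℝ (Fin 3)) → (EuclideanSpace ℝ (Fin 3))) (P : (EuclideanSpace ℝ (Fin 3)) → ℝ), IsSelfSimilarEulerProfile γ c V P →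
    ∀ (s₁ s₂ T₀ : ℝ), s₁ ≤ s₂ → 0 < T₀ →
      ∫ σ in s₁..s₂, (P (σ • eZ) - circleAvg P σ T₀)
        = (∫ σ in s₁..s₂, ∫ t in (0 : ℝ)..T₀, circleAvg (fun y => radialVelocity V y ^ 2 - swirlVelocity V y ^ 2) σ t / t)
          - (1 / 2) * (∫ σ in s₁..s₂, (‖V (σ • eZ)‖ ^ 2 - axialVelocity V (σ • eZ) ^ 2))
          + (1 - 3 * γ) * (∫ σ in s₁..s₂, ∫ t in (0 : ℝ)..T₀, circleAvg (radialVelocity V) σ t)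
          + (∫ σ in s₁..s₂, circleAvg (fun y => (γ * cylRadius y + radialVelocity V y) * radialVelocity V y) σ T₀)
          + (endTermC γ c V T₀ s₂ - endTermC γ c V T₀ s₁)
          - (offsetTerm γ c V T₀ s₂ - offsetTerm γ c V T₀ s₁)

end Summit.NavierStokesRegularity.NavierStokesRegularity.Theorems.PowerGaugeEulerLiouville.HoopCore

end
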